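import Summits.NavierStokesRegularity.FunctionalMining.NoGo.ProfileIntegrals
import HarnessLib

/-!
# One-dimensional pair integrals `∫ tᵐ f⁽ʲ¹⁾ f⁽ʲ²⁾` and their reduction to `∫ (f⁽ˡ⁾)²`

Search for candidate a priori estimates; no regularity claim. NS FUNCTIONAL MINING — NO-GO BRANCH
(cell `pub-nsfunc`, prove seat gen 3); one-dimensional toolkit for the log-door witness N6
(`NoGo/LogDoorPacket.lean`: a shear packet in a linear strain field).

For a smooth compactly supported profile `f : ℝ → ℝ` (vanishing for `2 < |t|`, the convention of
`NoGo/ProfileIntegrals.lean`) we set `pw f j₁ j₂ m (t) = tᵐ · f⁽ʲ¹⁾(t) f⁽ʲ²⁾(t)`,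
`Jw f j₁ j₂ m = ∫ pw f j₁ j₂ m` and `Sq f l = ∫ (f⁽ˡ⁾)²`. Integration by parts gives the two
shift rules `Jw (j₁+1) j₂ 0 + Jw j₁ (j₂+1) 0 = 0` and
`Jw j₁ j₂ 0 + Jw (j₁+1) j₂ 1 + Jw j₁ (j₂+1) 1 = 0` (`Jw_shift0`, `Jw_shift1`), whence every pair
integral met in the packet expansion is a rational multiple of some `Sq f l`
(`Jw_020 … Jw_251`; no parity hypothesis is needed). Folklore calculus; nothing is asserted about
Navier–Stokes.
-/

open MeasureTheory Set Function
open scoped ContDiff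

namespace Summit.NavierStokesRegularity.FunctionalMining

namespace Sep3

section Pair

variable {f : ℝ → ℝ}

/-- `pw f j₁ j₂ m (t) = tᵐ · f⁽ʲ¹⁾(t) · f⁽ʲ²⁾(t)`. [folklore] -/
noncomputable def pw (f : ℝ → ℝ) (j₁ j₂ m : ℕ) (t : ℝ) : ℝ :=
  t ^ m * (iteratedDeriv j₁ f t * iteratedDeriv j₂ f t)

/-- `Jw f j₁ j₂ m = ∫ tᵐ f⁽ʲ¹⁾ f⁽ʲ²⁾`. [folklore] -/
noncomputable def Jw (f : ℝ → ℝ) (j₁ j₂ m : ℕ) : ℝ := ∫ t, pw f j₁ j₂ m t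

/-- `Sq f l = ∫ (f⁽ˡ⁾)² = ‖f⁽ˡ⁾‖₂²`. [folklore] -/
noncomputable def Sq (f : ℝ → ℝ) (l : ℕ) : ℝ := ∫ t, iteratedDeriv l f t ^ 2

/-- `Sq f l = Jw f l l 0`. [folklore] -/
theorem Sq_eq_Jw (f : ℝ → ℝ) (l : ℕ) : Sq f l = Jw f l l 0 := by
  simp only [Sq, Jw, pw, pow_zero, one_mul, sq]

/-- `0 ≤ Sq f l`. [folklore] -/
theorem Sq_nonneg (f : ℝ → ℝ) (l : ℕ) : 0 ≤ Sq f l :=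
  integral_nonneg fun _ => sq_nonneg _

/-- `Jw` is symmetric in the two derivative orders. [folklore] -/
theorem Jw_comm (f : ℝ → ℝ) (j₁ j₂ m : ℕ) : Jw f j₁ j₂ m = Jw f j₂ j₁ m := by
  simp only [Jw, pw]; congr 1; funext t; ring

/-- `pw f j₁ j₂ m` is continuous for smooth `f`. [folklore] -/
theorem continuous_pw (hf : ContDiff ℝ ∞ f) (j₁ j₂ m : ℕ) : Continuous (pw f j₁ j₂ m) :=
  (continuous_id.pow m).mul
    ((hf.continuous_iteratedDeriv _ (by exact_mod_cast le_top)).mul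
      (hf.continuous_iteratedDeriv _ (by exact_mod_cast le_top)))

/-- `pw f j₁ j₂ m` vanishes where `f` does (`2 < |t|`). [folklore] -/
theorem pw_eq_zero (h0 : ∀ t, 2 < |t| → f t = 0) (j₁ j₂ m : ℕ) {t : ℝ} (ht : 2 < |t|) :
    pw f j₁ j₂ m t = 0 := by
  simp [pw, iteratedDeriv_eq_zero_of_abs_lt h0 _ t ht]

/-- `pw f j₁ j₂ m` has compact support (in `[-2, 2]`). [folklore] -/
theorem hasCompactSupport_pw (h0 : ∀ t, 2 < |t| → f t = 0) (j₁ j₂ m : ℕ) :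
    HasCompactSupport (pw f j₁ j₂ m) :=
  HasCompactSupport.intro isCompact_Icc fun _ ht =>
    pw_eq_zero h0 j₁ j₂ m (two_lt_abs_of_not_mem_Icc ht)

/-- `pw f j₁ j₂ m` is integrable. [folklore] -/
theorem integrable_pw (hf : ContDiff ℝ ∞ f) (h0 : ∀ t, 2 < |t| → f t = 0) (j₁ j₂ m : ℕ) :
    Integrable (pw f j₁ j₂ m) :=
  (continuous_pw hf j₁ j₂ m).integrable_of_hasCompactSupport (hasCompactSupport_pw h0 j₁ j₂ m)

/-- Product rule, weight `t⁰`. [folklore] -/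
theorem hasDerivAt_pw0 (hf : ContDiff ℝ ∞ f) (j₁ j₂ : ℕ) (t : ℝ) :
    HasDerivAt (pw f j₁ j₂ 0) (pw f (j₁ + 1) j₂ 0 t + pw f j₁ (j₂ + 1) 0 t) t := by
  have h1 := hasDerivAt_iteratedDeriv hf j₁ t
  have h2 := hasDerivAt_iteratedDeriv hf j₂ t
  have h := h1.mul h2
  have hfun : pw f j₁ j₂ 0 = fun s => iteratedDeriv j₁ f s * iteratedDeriv j₂ f s := by
    funext s; simp [pw]
  rw [hfun]
  refine h.congr_deriv ?_
  simp only [pw, pow_zero, one_mul]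

/-- Product rule, weight `t¹`. [folklore] -/
theorem hasDerivAt_pw1 (hf : ContDiff ℝ ∞ f) (j₁ j₂ : ℕ) (t : ℝ) :
    HasDerivAt (pw f j₁ j₂ 1)
      (pw f j₁ j₂ 0 t + pw f (j₁ + 1) j₂ 1 t + pw f j₁ (j₂ + 1) 1 t) t := by
  have h1 := hasDerivAt_iteratedDeriv hf j₁ t
  have h2 := hasDerivAt_iteratedDeriv hf j₂ t
  have h := (hasDerivAt_id t).mul (h1.mul h2)
  have hfun : pw f j₁ j₂ 1 = fun s => id s * (iteratedDeriv j₁ f s * iteratedDeriv j₂ f s) := by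
    funext s; simp [pw]
  rw [hfun]
  refine h.congr_deriv ?_
  simp only [pw, pow_zero, pow_one, one_mul, id, Pi.mul_apply]
  try ring

/-- INTEGRATION BY PARTS, weight `t⁰`: `Jw (j₁+1) j₂ 0 + Jw j₁ (j₂+1) 0 = 0`. [folklore] -/
theorem Jw_shift0 (hf : ContDiff ℝ ∞ f) (h0 : ∀ t, 2 < |t| → f t = 0) (j₁ j₂ : ℕ) :
    Jw f (j₁ + 1) j₂ 0 + Jw f j₁ (j₂ + 1) 0 = 0 := by
  have hI := fun a b m => integrable_pw hf h0 a b m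
  have hsum : Integrable (fun t => pw f (j₁ + 1) j₂ 0 t + pw f j₁ (j₂ + 1) 0 t) :=
    (hI _ _ _).add (hI _ _ _)
  have h := integral_eq_zero_of_hasDerivAt_of_integrable (hasDerivAt_pw0 hf j₁ j₂) hsum (hI _ _ _)
  rw [integral_add (hI _ _ _) (hI _ _ _)] at h
  simpa [Jw] using h

/-- INTEGRATION BY PARTS, weight `t¹`: `Jw j₁ j₂ 0 + Jw (j₁+1) j₂ 1 + Jw j₁ (j₂+1) 1 = 0`.
[folklore] -/
theorem Jw_shift1 (hf : ContDiff ℝ ∞ f) (h0 : ∀ t, 2 < |t| → f t = 0) (j₁ j₂ : ℕ) :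
    Jw f j₁ j₂ 0 + Jw f (j₁ + 1) j₂ 1 + Jw f j₁ (j₂ + 1) 1 = 0 := by
  have hI := fun a b m => integrable_pw hf h0 a b m
  have hsum : Integrable (fun t => pw f j₁ j₂ 0 t + pw f (j₁ + 1) j₂ 1 t + pw f j₁ (j₂ + 1) 1 t) :=
    ((hI _ _ _).add (hI _ _ _)).add (hI _ _ _)
  have h12 : Integrable (fun t => pw f j₁ j₂ 0 t + pw f (j₁ + 1) j₂ 1 t) := (hI _ _ _).add (hI _ _ _)
  have h := integral_eq_zero_of_hasDerivAt_of_integrable (hasDerivAt_pw1 hf j₁ j₂) hsum (hI _ _ _)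
  rw [integral_add h12 (hI _ _ _), integral_add (hI _ _ _) (hI _ _ _)] at h
  simpa [Jw] using h

/-! ## The reductions used by the packet expansion -/

/-- `∫ f f'' = -∫ f'²`. [folklore] -/
theorem Jw_020 (hf : ContDiff ℝ ∞ f) (h0 : ∀ t, 2 < |t| → f t = 0) : Jw f 0 2 0 = -Sq f 1 := by
  have h := Jw_shift0 hf h0 0 1
  rw [Sq_eq_Jw]; linarith

/-- `∫ f' f''' = -∫ f''²`. [folklore] -/
theorem Jw_130 (hf : ContDiff ℝ ∞ f) (h0 : ∀ t, 2 < |t| → f t = 0) : Jw f 1 3 0 = -Sq f 2 := by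
  have h := Jw_shift0 hf h0 1 2
  rw [Sq_eq_Jw]; linarith

/-- `∫ f f'''' = ∫ f''²`. [folklore] -/
theorem Jw_040 (hf : ContDiff ℝ ∞ f) (h0 : ∀ t, 2 < |t| → f t = 0) : Jw f 0 4 0 = Sq f 2 := by
  have h := Jw_shift0 hf h0 0 3
  rw [Jw_130 hf h0] at h
  linarith

/-- `∫ f'' f'''' = -∫ f'''²`. [folklore] -/
theorem Jw_240 (hf : ContDiff ℝ ∞ f) (h0 : ∀ t, 2 < |t| → f t = 0) : Jw f 2 4 0 = -Sq f 3 := by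
  have h := Jw_shift0 hf h0 2 3
  rw [Sq_eq_Jw]; linarith

/-- `∫ f' f⁽⁵⁾ = ∫ f'''²`. [folklore] -/
theorem Jw_150 (hf : ContDiff ℝ ∞ f) (h0 : ∀ t, 2 < |t| → f t = 0) : Jw f 1 5 0 = Sq f 3 := by
  have h := Jw_shift0 hf h0 1 4
  rw [Jw_240 hf h0] at h
  linarith

/-- `∫ t f f' = -½ ∫ f²`. [folklore] -/
theorem Jw_011 (hf : ContDiff ℝ ∞ f) (h0 : ∀ t, 2 < |t| → f t = 0) :
    Jw f 0 1 1 = -(Sq f 0) / 2 := by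
  have h := Jw_shift1 hf h0 0 0
  rw [Jw_comm f 1 0 1, Sq_eq_Jw] at *
  linarith

/-- `∫ t f' f'' = -½ ∫ f'²`. [folklore] -/
theorem Jw_121 (hf : ContDiff ℝ ∞ f) (h0 : ∀ t, 2 < |t| → f t = 0) :
    Jw f 1 2 1 = -(Sq f 1) / 2 := by
  have h := Jw_shift1 hf h0 1 1
  rw [Jw_comm f 2 1 1, Sq_eq_Jw] at *
  linarith

/-- `∫ t f'' f''' = -½ ∫ f''²`. [folklore] -/
theorem Jw_231 (hf : ContDiff ℝ ∞ f) (h0 : ∀ t, 2 < |t| → f t = 0) :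
    Jw f 2 3 1 = -(Sq f 2) / 2 := by
  have h := Jw_shift1 hf h0 2 2
  rw [Jw_comm f 3 2 1, Sq_eq_Jw] at *
  linarith

/-- `∫ t f''' f'''' = -½ ∫ f'''²`. [folklore] -/
theorem Jw_341 (hf : ContDiff ℝ ∞ f) (h0 : ∀ t, 2 < |t| → f t = 0) :
    Jw f 3 4 1 = -(Sq f 3) / 2 := by
  have h := Jw_shift1 hf h0 3 3
  rw [Jw_comm f 4 3 1, Sq_eq_Jw] at *
  linarith

/-- `∫ t f' f'''' = (3/2) ∫ f''²`. [folklore] -/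
theorem Jw_141 (hf : ContDiff ℝ ∞ f) (h0 : ∀ t, 2 < |t| → f t = 0) :
    Jw f 1 4 1 = 3 / 2 * Sq f 2 := by
  have h := Jw_shift1 hf h0 1 3
  rw [Jw_130 hf h0, Jw_231 hf h0] at h
  linarith

/-- `∫ t f'' f⁽⁵⁾ = (3/2) ∫ f'''²`. [folklore] -/
theorem Jw_251 (hf : ContDiff ℝ ∞ f) (h0 : ∀ t, 2 < |t| → f t = 0) :
    Jw f 2 5 1 = 3 / 2 * Sq f 3 := by
  have h := Jw_shift1 hf h0 2 4
  rw [Jw_240 hf h0, Jw_341 hf h0] at h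
  linarith

end Pair

end Sep3

end Summit.NavierStokesRegularity.FunctionalMining
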